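import Summits.Parity.GeneralizedHardyLittlewood.Theses.LiouvilleOpening
import Literature.NumberTheory.Sieve.LinearEquationsInPrimesTwinSystem
import Literature.NumberTheory.Sieve.ParityWave0LogChowlaLiouvilleHolds
import Literature.Barriers.Parity.SiegelZeroDichotomy
import Literature.Barriers.Parity.LogarithmicAveraging
import HarnessLib

/-!
# Crux `PairLiouvilleLaw` (stmt-Parity-16147) — strategist census, kernel-checked part

Route `LiouvilleOpening` (sub-problem `GeneralizedHardyLittlewood` of `Parity`), redirect strategist r1.
This file proves, sorry-free, the three facts the STRATEGY-CENSUS.md verdict rests on: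

1. **Costume modulo the sibling crux.** `law_iff_target_of_chowla :
   ChowlaNatural → (PairLiouvilleLaw ↔ RelativePairs ∧ CofBoundEv)`: given the route's own rank-4 crux
   `ChowlaNatural` (natural-density two-point Chowla along pairs of forms), the crux is EXACTLY the route's
   TARGET `RelativePairs` (uniform Hardy–Littlewood for pairs) plus `CofBoundEv`, the bookkeeping bound
   `|𝔠_Ψ| ≤ K_L (1 + |𝔖_Ψ|)` on its own cofactor constant (a literal conjunct of the crux).  The forward
   direction is the route's `closes` inlined (`relativePairs_of_law`); the backward direction is the triangle
   inequality (`law_of_relativePairs`).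
2. **The summit gives the target outright.** `relativePairs_of_ghl : GeneralizedHardyLittlewood → RelativePairs`
   (specialise `d = 1`, `t = 2`); so `S → PairLiouvilleLaw` fails only for want of `ChowlaNatural ∧ CofBoundEv`,
   and `PairLiouvilleLaw → S` fails for want of `ChowlaNatural` and the declared residual `RelativePairsToGHL`
   (probes: `bc/PairLiouvilleLaw_probe.lean`, both batteries fail).
3. **Twin-prime hardness of the crux ALONE.** `twinPrimeConjecture_of_pairLiouvilleLaw :
   PairLiouvilleLaw → TwinPrimeConjecture`, unconditionally in the tree: the law at `L = 3`, `ε = 1/8` on the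
   twin system `n ↦ (n, n+2)` over `K = [−N, N]` reads `|S(N) − N𝔖 − 𝔠·C(N)| ≤ (1+𝔖)N/8` with
   `S(N) = ∑_{n ≤ N} Λ(n)Λ(n+2)`, `C(N) = ∑_{n ≤ N} λ(n)λ(n+2)`, `𝔖 ≥ 1`
   (`Literature.NumberTheory.Sieve.LinearEquationsInPrimesTwinSystem`); without twin primes `S(N) ≤ N/8`
   eventually (`Literature.Barriers.Parity.pairSum_le_of_noTwinAbove`, `eventually_pairSumBound_le`), whence
   `|𝔠|·|C(N)| ≥ 5N/8` for ALL large `N`; but Tao's logarithmically averaged two-point Chowla theorem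
   (`Literature.NumberTheory.Sieve.tao_log_chowla_liouville_holds`, PROVED in the tree) makes `|C(N)|/N` small
   for arbitrarily large `N` (`Literature.Barriers.Parity.HasLogMeanValue.frequently_abs_sub_lt`) — contradiction.
   So no proof of the crux can be easier than a proof of the twin prime conjecture.

Nothing here is a route item or a Theorems file; it is strategist evidence (crux workfile).
-/

noncomputable section

open scoped BigOperators Topology Classical ArithmeticFunction.vonMangoldt
open Filter Finset Literature.NumberTheory.Sieve

namespace Summit.Parity.GeneralizedHardyLittlewood.Cruxes.PairLiouvilleLaw.Strategist

open Summit.Parity.GeneralizedHardyLittlewood.Theses.LiouvilleOpening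

/-! ## Readable names for the two opaque pieces of the crux -/

/-- The Liouville cofactor constant `𝔠_Ψ` — the `limUnder` term of the crux, verbatim. -/
def cof (Ψ : Fin 2 → AffLinForm 1) : ℝ :=
  Filter.limUnder Filter.atTop (fun y : ℕ => ∑ k ∈ Finset.Icc 1 y, ∑ l ∈ Finset.Icc 1 y,
    ∑ b ∈ Finset.Icc 1 y, ∑ d ∈ Finset.Icc 1 y, (ArithmeticFunction.moebius k : ℝ) *
      (ArithmeticFunction.moebius l : ℝ) * (ArithmeticFunction.liouville b : ℝ) *
      (ArithmeticFunction.liouville d : ℝ) * Real.log b * Real.log d *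
      ((((Finset.range ((k ^ 2 * b) * (l ^ 2 * d))).filter fun r : ℕ =>
        ((k ^ 2 * b : ℕ) : ℤ) ∣ (Ψ 0).eval (fun _ => (r : ℤ)) ∧
          ((l ^ 2 * d : ℕ) : ℤ) ∣ (Ψ 1).eval (fun _ => (r : ℤ))).card : ℝ) /
        (((k ^ 2 * b) * (l ^ 2 * d) : ℕ) : ℝ)))

/-- The pair Chowla sum `C_Ψ(K, N) = ∑_{n ∈ K ∩ [−N,N]} λ(ψ₁(n)) λ(ψ₂(n))` — verbatim from the crux. -/
def chowlaSum (Ψ : Fin 2 → AffLinForm 1) (K : Set (Fin 1 → ℝ)) (N : ℕ) : ℝ :=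
  ∑ n ∈ @Finset.filter (Fin 1 → ℤ) (fun n => realPoint n ∈ K) (Classical.decPred _) (latticeBox 1 N),
    ∏ i, ((ArithmeticFunction.liouville (Int.toNat ((Ψ i).eval n)) : ℤ) : ℝ)

/-- The crux in readable form (definitionally the route decl). -/
def LawReadable : Prop :=
  ∀ L : ℕ, ∃ Kc : ℝ, ∀ ε : ℝ, 0 < ε → ∃ N₀ : ℕ, ∀ N : ℕ, N₀ ≤ N →
    ∀ Ψ : Fin 2 → AffLinForm 1, IsNondegenerateSystem Ψ → affLinSize Ψ N ≤ L →
      |cof Ψ| ≤ Kc * (1 + |singularProduct Ψ|) ∧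
        ∀ K : Set (Fin 1 → ℝ), Convex ℝ K → K ⊆ realBox 1 N →
          |vonMangoldtSum Ψ K N - archFactor Ψ K * singularProduct Ψ - cof Ψ * chowlaSum Ψ K N| ≤
            ε * (1 + |singularProduct Ψ|) * (N : ℝ)

/-- `PairLiouvilleLaw` IS `LawReadable`, by `Iff.rfl`. -/
theorem pairLiouvilleLaw_iff_readable : PairLiouvilleLaw ↔ LawReadable := Iff.rfl

/-- The eventual cofactor bound — a literal conjunct of the crux (its `ε`-free half). -/
def CofBoundEv : Prop :=
  ∀ L : ℕ, ∃ Kc : ℝ, ∃ N₀ : ℕ, ∀ N : ℕ, N₀ ≤ N → ∀ Ψ : Fin 2 → AffLinForm 1,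
    IsNondegenerateSystem Ψ → affLinSize Ψ N ≤ L → |cof Ψ| ≤ Kc * (1 + |singularProduct Ψ|)

/-! ## 1. Costume: modulo `ChowlaNatural` the crux is the target plus its own bookkeeping -/

/-- The crux implies its cofactor conjunct (take `ε = 1`). -/
theorem cofBoundEv_of_law (hLaw : PairLiouvilleLaw) : CofBoundEv := by
  intro L
  obtain ⟨Kc, hK⟩ := hLaw L
  obtain ⟨N₀, hN₀⟩ := hK 1 one_pos
  exact ⟨Kc, N₀, fun N hN Ψ hΨ hL => (hN₀ N hN Ψ hΨ hL).1⟩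

/-- Real-variable core of `closes`: `|S − cC| ≤ (ε/2)(1+s)N`, `|c| ≤ K'(1+s)`, `|C| ≤ εN/(2(K'+1))`
give `|S| ≤ ε(1+s)N`. -/
theorem key_forward (S c C s N ε K' : ℝ) (hs : 0 ≤ s) (hN : 0 ≤ N) (hε : 0 < ε) (hK' : 0 ≤ K')
    (hc : |c| ≤ K' * (1 + s)) (h1 : |S - c * C| ≤ ε / 2 * (1 + s) * N)
    (h2 : |C| ≤ ε / (2 * (K' + 1)) * N) : |S| ≤ ε * (1 + s) * N := by
  have htri : |S| ≤ |S - c * C| + |c| * |C| := by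
    calc |S| = |(S - c * C) + c * C| := by ring_nf
      _ ≤ |S - c * C| + |c * C| := abs_add_le _ _
      _ = |S - c * C| + |c| * |C| := by rw [abs_mul]
  have hcC : |c| * |C| ≤ K' * (1 + s) * (ε / (2 * (K' + 1)) * N) :=
    mul_le_mul hc h2 (abs_nonneg _) (by positivity)
  have hK1 : K' / (K' + 1) ≤ 1 := by
    rw [div_le_one (by positivity)]; linarith
  calc |S| ≤ |S - c * C| + |c| * |C| := htri
    _ ≤ ε / 2 * (1 + s) * N + K' * (1 + s) * (ε / (2 * (K' + 1)) * N) := add_le_add h1 hcC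
    _ = ε / 2 * (1 + s) * N + (K' / (K' + 1)) * (ε / 2 * (1 + s) * N) := by
        field_simp
    _ ≤ ε / 2 * (1 + s) * N + 1 * (ε / 2 * (1 + s) * N) := by
        gcongr
    _ = ε * (1 + s) * N := by ring

/-- The same triangle inequality read backwards: `|S| ≤ (ε/2)(1+s)N`, `|c| ≤ K'(1+s)`,
`|C| ≤ εN/(2(K'+1))` give `|S − cC| ≤ ε(1+s)N`. -/
theorem key_backward (S c C s N ε K' : ℝ) (hs : 0 ≤ s) (hN : 0 ≤ N) (hε : 0 < ε) (hK' : 0 ≤ K')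
    (hc : |c| ≤ K' * (1 + s)) (h1 : |S| ≤ ε / 2 * (1 + s) * N)
    (h2 : |C| ≤ ε / (2 * (K' + 1)) * N) : |S - c * C| ≤ ε * (1 + s) * N := by
  have htri : |S - c * C| ≤ |S| + |c| * |C| := by
    calc |S - c * C| ≤ |S| + |c * C| := abs_sub _ _
      _ = |S| + |c| * |C| := by rw [abs_mul]
  have hcC : |c| * |C| ≤ K' * (1 + s) * (ε / (2 * (K' + 1)) * N) :=
    mul_le_mul hc h2 (abs_nonneg _) (by positivity)
  have hK1 : K' / (K' + 1) ≤ 1 := by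
    rw [div_le_one (by positivity)]; linarith
  calc |S - c * C| ≤ |S| + |c| * |C| := htri
    _ ≤ ε / 2 * (1 + s) * N + K' * (1 + s) * (ε / (2 * (K' + 1)) * N) := add_le_add h1 hcC
    _ = ε / 2 * (1 + s) * N + (K' / (K' + 1)) * (ε / 2 * (1 + s) * N) := by
        field_simp
    _ ≤ ε / 2 * (1 + s) * N + 1 * (ε / 2 * (1 + s) * N) := by
        gcongr
    _ = ε * (1 + s) * N := by ring

/-- **Crux ∧ ChowlaNatural ⟹ target** (this is the route's `closes`, minus the residual). -/
theorem relativePairs_of_law (hLaw : PairLiouvilleLaw) (hCh : ChowlaNatural) : RelativePairs := by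
  intro L ε hε
  obtain ⟨Kc, hK⟩ := hLaw L
  set K' : ℝ := max Kc 0 with hK'def
  have hK'0 : 0 ≤ K' := le_max_right _ _
  have hKle : Kc ≤ K' := le_max_left _ _
  obtain ⟨N₁, hN₁⟩ := hK (ε / 2) (by positivity)
  obtain ⟨N₂, hN₂⟩ := hCh L (ε / (2 * (K' + 1))) (by positivity)
  refine ⟨max N₁ N₂, fun N hN Ψ hΨ hL K hKc hKN => ?_⟩
  obtain ⟨hc, hlaw⟩ := hN₁ N (le_of_max_le_left hN) Ψ hΨ hL
  have h1 := hlaw K hKc hKN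
  have h2 := hN₂ N (le_of_max_le_right hN) Ψ hΨ hL K hKc hKN
  have hs0 : 0 ≤ |singularProduct Ψ| := abs_nonneg _
  have hN0 : (0 : ℝ) ≤ N := Nat.cast_nonneg N
  have hc' := hc.trans
    (mul_le_mul_of_nonneg_right hKle (by positivity) :
      Kc * (1 + |singularProduct Ψ|) ≤ K' * (1 + |singularProduct Ψ|))
  exact key_forward _ _ _ _ N ε K' hs0 hN0 hε hK'0 hc' h1 h2

/-- **Target ∧ ChowlaNatural ∧ CofBoundEv ⟹ crux**: the converse costume direction. -/
theorem law_of_relativePairs (hRP : RelativePairs) (hCh : ChowlaNatural) (hCof : CofBoundEv) :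
    PairLiouvilleLaw := by
  intro L
  obtain ⟨Kc, N₀, hKc⟩ := hCof L
  set K' : ℝ := max Kc 0 with hK'def
  have hK'0 : 0 ≤ K' := le_max_right _ _
  have hKle : Kc ≤ K' := le_max_left _ _
  refine ⟨Kc, fun ε hε => ?_⟩
  obtain ⟨N₁, hN₁⟩ := hRP L (ε / 2) (by positivity)
  obtain ⟨N₂, hN₂⟩ := hCh L (ε / (2 * (K' + 1))) (by positivity)
  refine ⟨max N₀ (max N₁ N₂), fun N hN Ψ hΨ hL => ?_⟩
  have hN0' : N₀ ≤ N := le_of_max_le_left hN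
  have hN1' : N₁ ≤ N := le_of_max_le_left (le_of_max_le_right hN)
  have hN2' : N₂ ≤ N := le_of_max_le_right (le_of_max_le_right hN)
  have hc : |cof Ψ| ≤ Kc * (1 + |singularProduct Ψ|) := hKc N hN0' Ψ hΨ hL
  refine ⟨hc, fun K hK hKN => ?_⟩
  have h1 := hN₁ N hN1' Ψ hΨ hL K hK hKN
  have h2 : |chowlaSum Ψ K N| ≤ ε / (2 * (K' + 1)) * N := hN₂ N hN2' Ψ hΨ hL K hK hKN
  have hs0 : 0 ≤ |singularProduct Ψ| := abs_nonneg _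
  have hN0 : (0 : ℝ) ≤ N := Nat.cast_nonneg N
  have hc' := hc.trans
    (mul_le_mul_of_nonneg_right hKle (by positivity) :
      Kc * (1 + |singularProduct Ψ|) ≤ K' * (1 + |singularProduct Ψ|))
  show |vonMangoldtSum Ψ K N - archFactor Ψ K * singularProduct Ψ - cof Ψ * chowlaSum Ψ K N| ≤
    ε * (1 + |singularProduct Ψ|) * N
  exact key_backward _ _ _ _ N ε K' hs0 hN0 hε hK'0 hc' h1 h2

/-- **COSTUME CERTIFICATE.** Modulo the route's own sibling crux `ChowlaNatural`, the crux
`PairLiouvilleLaw` is equivalent to the route's TARGET `RelativePairs` together with the cofactor bound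
`CofBoundEv` (a literal conjunct of the crux). -/
theorem law_iff_target_of_chowla (hCh : ChowlaNatural) :
    PairLiouvilleLaw ↔ (RelativePairs ∧ CofBoundEv) :=
  ⟨fun h => ⟨relativePairs_of_law h hCh, cofBoundEv_of_law h⟩,
    fun h => law_of_relativePairs h.1 hCh h.2⟩

/-! ## 2. The summit gives the target by specialisation -/

/-- `GeneralizedHardyLittlewood → RelativePairs`: `d = 1`, `t = 2`, and `εN ≤ ε(1 + |𝔖|)N`. -/
theorem relativePairs_of_ghl (h : _root_.GeneralizedHardyLittlewood) : RelativePairs := by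
  intro L ε hε
  obtain ⟨N₀, hN₀⟩ := h 1 2 L le_rfl (by norm_num) ε hε
  refine ⟨N₀, fun N hN Ψ hΨ hL K hK hKN => ?_⟩
  have h1 := hN₀ N hN Ψ hΨ hL K hK hKN
  rw [pow_one] at h1
  refine h1.trans ?_
  have hs : 0 ≤ |singularProduct Ψ| := abs_nonneg _
  have hN0 : (0 : ℝ) ≤ N := Nat.cast_nonneg N
  nlinarith [mul_nonneg (mul_nonneg hε.le hs) hN0]

/-- Hence, given `ChowlaNatural ∧ CofBoundEv`, the summit implies the crux. -/
theorem law_of_ghl (h : _root_.GeneralizedHardyLittlewood) (hCh : ChowlaNatural) (hCof : CofBoundEv) :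
    PairLiouvilleLaw :=
  law_of_relativePairs (relativePairs_of_ghl h) hCh hCof

/-! ## 3. Twin-prime hardness of the crux alone -/

/-- `|λ(n)| ≤ 1` in `ℝ`. [folklore] -/
theorem abs_liouville_real_le_one (n : ℕ) : |((ArithmeticFunction.liouville n : ℤ) : ℝ)| ≤ 1 := by
  rcases eq_or_ne n 0 with rfl | hn
  · simp
  · rw [ArithmeticFunction.liouville_apply hn]
    push_cast
    rw [abs_pow, abs_neg, abs_one, one_pow]

/-- The Chowla sum of the crux, for the twin system over the full box, is `∑_{n=1}^{N} λ(n)λ(n+2)`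
(terms with `n ≤ 0` vanish since `λ(toNat n) = λ(0) = 0`). -/
theorem chowlaSum_twinPrimeSystem (N : ℕ) :
    chowlaSum twinPrimeSystem (realBox 1 N) N =
      ∑ n ∈ Icc 1 N, ((ArithmeticFunction.liouville n : ℤ) : ℝ) *
        ((ArithmeticFunction.liouville (n + 2) : ℤ) : ℝ) := by
  unfold chowlaSum
  rw [Finset.filter_true_of_mem]
  swap
  · intro n hn
    have hn' := Fintype.mem_piFinset.mp hn
    simp only [realBox, Set.mem_Icc]
    refine ⟨fun j => ?_, fun j => ?_⟩
    · have := (Finset.mem_Icc.mp (hn' j)).1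
      simp only [realPoint]; exact_mod_cast this
    · have := (Finset.mem_Icc.mp (hn' j)).2
      simp only [realPoint]; exact_mod_cast this
  unfold latticeBox
  rw [sum_piFinset_const_fin_one]
  simp only [Fin.prod_univ_two, twinPrimeSystem_eval_zero, twinPrimeSystem_eval_one]
  have hsub : Icc (1 : ℤ) N ⊆ Icc (-(N : ℤ)) N := Icc_subset_Icc (by omega) le_rfl
  rw [← Finset.sum_subset hsub]
  swap
  · intro m hm hm'
    simp only [Finset.mem_Icc, not_and, not_le] at hm hm'
    have hm0 : m ≤ 0 := by
      by_contra h
      exact absurd (hm' (by omega)) (by omega)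
    rw [Int.toNat_eq_zero.mpr hm0, ArithmeticFunction.map_zero, Int.cast_zero, zero_mul]
  refine Finset.sum_nbij' (fun m => m.toNat) (fun n => (n : ℤ)) (fun m hm => ?_) (fun n hn => ?_)
    (fun m hm => ?_) (fun n _ => by simp) (fun m hm => ?_)
  · simp only [Finset.mem_Icc] at hm ⊢; omega
  · simp only [Finset.mem_Icc] at hn ⊢; omega
  · simp only [Finset.mem_Icc] at hm; omega
  · simp only [Finset.mem_Icc] at hm
    rw [show (m + 2).toNat = m.toNat + 2 by omega]

/-- Tao's logarithmically averaged two-point Chowla theorem (PROVED in the tree) in the mean-value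
vocabulary of `Literature.Barriers.Parity`: `λ(n)λ(n+2)` has logarithmic mean value `0`.
[cite: TaoFMP2016, Theorem 1.2] -/
theorem hasLogMeanValue_pair :
    Literature.Barriers.Parity.HasLogMeanValue
      (fun n : ℕ => ((ArithmeticFunction.liouville n : ℤ) : ℝ) *
        ((ArithmeticFunction.liouville (n + 2) : ℤ) : ℝ)) 0 := by
  have h := (tao_log_chowla_liouville_holds 1 1 0 2 le_rfl le_rfl (by norm_num)).tendsto_div_nhds_zero
  unfold Literature.Barriers.Parity.HasLogMeanValue
  refine h.congr' (Eventually.of_forall fun X => ?_)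
  simp only [Literature.Barriers.Parity.logMean, one_mul, add_zero]

/-- Without twin primes above `n₀`, `∑_{n ≤ N} Λ(n)Λ(n+2) ≤ cN` for every `c > 0` and all large `N`
(tree: `pairSum_le_of_noTwinAbove`, `eventually_pairSumBound_le`). [folklore] -/
theorem twinSum_le_eventually {n₀ : ℕ} (hno : ∀ p : ℕ, n₀ < p → ¬ (p.Prime ∧ (p + 2).Prime))
    {c : ℝ} (hc : 0 < c) :
    ∃ N₂ : ℕ, ∀ N : ℕ, N₂ ≤ N → ∑ n ∈ Icc 1 N, Λ n * Λ (n + 2) ≤ c * N := by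
  obtain ⟨X₀, hX₀⟩ :=
    Filter.eventually_atTop.mp (Literature.Barriers.Parity.eventually_pairSumBound_le n₀ hc)
  refine ⟨⌈X₀⌉₊, fun N hN => ?_⟩
  have hNX : X₀ ≤ (N : ℝ) := (Nat.le_ceil X₀).trans (by exact_mod_cast hN)
  have h := hX₀ N hNX
  rw [Nat.floor_natCast] at h
  exact (Literature.Barriers.Parity.pairSum_le_of_noTwinAbove hno N).trans h

/-- **HARDNESS CERTIFICATE: the crux alone implies the twin prime conjecture.** -/
theorem twinPrimeConjecture_of_pairLiouvilleLaw (hLaw : PairLiouvilleLaw) : TwinPrimeConjecture := by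
  by_contra hT
  have hT' := hT
  unfold TwinPrimeConjecture at hT'
  push Not at hT'
  obtain ⟨n₀, hn₀⟩ := hT'
  have hno : ∀ p : ℕ, n₀ < p → ¬ (p.Prime ∧ (p + 2).Prime) := fun p hp h2 => hn₀ p hp h2.1 h2.2
  -- (i) eventually `S(N) ≤ N/8`
  obtain ⟨N₂, hN₂⟩ := twinSum_le_eventually hno (by norm_num : (0 : ℝ) < 1 / 8)
  -- (ii) the law at `L = 3`, `ε = 1/8`
  obtain ⟨Kc, hK⟩ := hLaw 3
  obtain ⟨N₀, hN₀⟩ := hK (1 / 8) (by norm_num)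
  have hs1 : 1 ≤ singularProduct twinPrimeSystem := one_le_singularProduct_twinPrimeSystem
  -- (iii) for all large `N`: `5N/8 ≤ |𝔠| · |C(N)|`
  have hbig : ∀ N : ℕ, max (max N₀ N₂) 2 ≤ N →
      5 / 8 * (N : ℝ) ≤ |cof twinPrimeSystem| *
        |∑ n ∈ Icc 1 N, ((ArithmeticFunction.liouville n : ℤ) : ℝ) *
          ((ArithmeticFunction.liouville (n + 2) : ℤ) : ℝ)| := by
    intro N hN
    have hN0' : N₀ ≤ N := le_of_max_le_left (le_of_max_le_left hN)
    have hN2' : N₂ ≤ N := le_of_max_le_right (le_of_max_le_left hN)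
    have hN2 : 2 ≤ N := le_of_max_le_right hN
    have hconv : Convex ℝ (realBox 1 (N : ℝ)) := convex_Icc _ _
    obtain ⟨-, hlaw⟩ := hN₀ N hN0' twinPrimeSystem isNondegenerateSystem_twinPrimeSystem.1
      (by exact_mod_cast affLinSize_twinPrimeSystem_le hN2)
    have h1 := hlaw (realBox 1 N) hconv subset_rfl
    have h1' : |vonMangoldtSum twinPrimeSystem (realBox 1 N) N -
        archFactor twinPrimeSystem (realBox 1 N) * singularProduct twinPrimeSystem -
        cof twinPrimeSystem * chowlaSum twinPrimeSystem (realBox 1 N) N| ≤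
        1 / 8 * (1 + |singularProduct twinPrimeSystem|) * N := h1
    rw [vonMangoldtSum_twinPrimeSystem, archFactor_twinPrimeSystem, chowlaSum_twinPrimeSystem,
      abs_of_nonneg (by linarith : (0 : ℝ) ≤ singularProduct twinPrimeSystem)] at h1'
    have hS := hN₂ N hN2'
    have hN0 : (0 : ℝ) ≤ N := Nat.cast_nonneg N
    have hlow := (abs_le.mp h1').1
    have hcC : cof twinPrimeSystem *
        (∑ n ∈ Icc 1 N, ((ArithmeticFunction.liouville n : ℤ) : ℝ) *
          ((ArithmeticFunction.liouville (n + 2) : ℤ) : ℝ)) ≤ -(5 / 8) * N := by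
      nlinarith [mul_nonneg (by linarith : (0 : ℝ) ≤ singularProduct twinPrimeSystem - 1) hN0]
    calc 5 / 8 * (N : ℝ) ≤ -(cof twinPrimeSystem *
          (∑ n ∈ Icc 1 N, ((ArithmeticFunction.liouville n : ℤ) : ℝ) *
            ((ArithmeticFunction.liouville (n + 2) : ℤ) : ℝ))) := by linarith
      _ ≤ _ := neg_le_abs _
      _ = _ := abs_mul _ _
  -- (iv) Tao: `|C(N)|/N` is small for arbitrarily large `N`
  have hB : ∀ n : ℕ, |(fun n : ℕ => ((ArithmeticFunction.liouville n : ℤ) : ℝ) *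
      ((ArithmeticFunction.liouville (n + 2) : ℤ) : ℝ)) n| ≤ 1 := fun n => by
    dsimp only
    rw [abs_mul]
    exact mul_le_one₀ (abs_liouville_real_le_one n) (abs_nonneg _)
      (abs_liouville_real_le_one (n + 2))
  have hε' : (0 : ℝ) < 5 / (8 * (|cof twinPrimeSystem| + 1)) := by positivity
  have hfreq := hasLogMeanValue_pair.frequently_abs_sub_lt hB hε'
  have hev : ∀ᶠ N : ℕ in atTop, ¬ |Literature.Barriers.Parity.cesaroMean
      (fun n : ℕ => ((ArithmeticFunction.liouville n : ℤ) : ℝ) *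
        ((ArithmeticFunction.liouville (n + 2) : ℤ) : ℝ)) N - 0| <
      5 / (8 * (|cof twinPrimeSystem| + 1)) := by
    filter_upwards [eventually_ge_atTop (max (max N₀ N₂) 2)] with N hN
    rw [not_lt, sub_zero]
    have hb := hbig N hN
    have hNpos : (0 : ℝ) < N := by exact_mod_cast (show 0 < N by omega)
    simp only [Literature.Barriers.Parity.cesaroMean]
    rw [abs_div, Nat.abs_cast, le_div_iff₀ hNpos, div_mul_eq_mul_div, div_le_iff₀ (by positivity)]
    have hP := abs_nonneg (∑ n ∈ Icc 1 N, ((ArithmeticFunction.liouville n : ℤ) : ℝ) *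
      ((ArithmeticFunction.liouville (n + 2) : ℤ) : ℝ))
    nlinarith [hP, abs_nonneg (cof twinPrimeSystem)]
  exact hfreq hev

/-- Contrapositive bookkeeping: a disproof of the twin prime conjecture refutes the crux. -/
theorem not_pairLiouvilleLaw_of_not_twinPrimeConjecture (h : ¬ TwinPrimeConjecture) :
    ¬ PairLiouvilleLaw := fun hLaw => h (twinPrimeConjecture_of_pairLiouvilleLaw hLaw)

end Summit.Parity.GeneralizedHardyLittlewood.Cruxes.PairLiouvilleLaw.Strategist
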